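import Summits.CriticalPhenomena.PercolationContinuityZ3.Theorems.PercNearOneGluingNoHeavyQuantSliceConeForm
import Summits.CriticalPhenomena.PercolationContinuityZ3.Theorems.PercNearOneGluingNoHeavyQuantGatedConvSplit
import Summits.CriticalPhenomena.PercolationContinuityZ3.Theorems.PercNearOneGluingNoHeavyQuantTreeBuiltRows
import Summits.CriticalPhenomena.PercolationContinuityZ3.Theorems.PercNearOneGluingNoHeavyQuantTreeDECOfSDEC
import HarnessLib

/-!
# QUANT lane R8, T-DEC: THE GATE INTERACTION OF `SDECConvClosed` ISOLATED — gate-stable DEC is conv-closed as soon as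
# (i) DEC at explicit targets is conv-closed (`LawDec.ConvClosedT`) and (ii) the EMPTY-FREE gated convolution is DEC
# (`LawDec.GatedConvEmptyFree`: one factor has no atom at `0`); hence `ConvClosedT ∧ GatedConvEmptyFree ⟹ TreeBuiltDEC, TreeDEC, FarTreeRow`

builds on p205010 (kernel theorem, internal audit signed; external expert review pending)

Statement + support file (`--supports stmt-CriticalPhenomena-4575`), QUANT lane typer seat prim-quant-stmt (gen 25), rung R8 of
`run/shared/lean/prim/quant/LADDER.md`.  One `Prop` (`LawDec.SDECUpTo`), one `@[conjecture]` (`LawDec.GatedConvEmptyFree`), theorems with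
standard axioms, no sorries.  Part 2 of 2; part 1 is `…QuantGatedConvSplit` (the split identity `gate_lconv_split`, `posPart`, `coPart`).  Continues census-2 g53's `…QuantSDEC` (`gate`, `lconv`, `SDEC`, `@[conjecture] SDECConvClosed`, `TreeBuilt`),
lead g22's `…QuantSliceConeForm` (`@[conjecture] ConvClosedT`, `decAt_lconv_of_convClosedT`), lead g20's bridges `…QuantFarTreeRowOfTreeBuilt` /
`…QuantTreeDECOfSDEC` and typer g22's `…QuantTreeBuiltRows`.

WHY.  The law-level route of record to the tree row is `SDECConvClosed ⟹ TreeBuiltDEC ⟹ TreeBuiltFAR ⟹ Quant.FarTreeRow` (all kernel but the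
first arrow's hypothesis).  `SDECConvClosed` asks, for SDEC factors `μ₁, μ₂` at floor `x` and EVERY gate `q ∈ (0,1]`, that the gated convolution
`gate_q(μ₁ ∗ μ₂) = (1−q)δ₀ + q·(μ₁ ∗ μ₂)` (a common gate above two independent subtrees) be DEC at every layer at floor `q·x`.  The census
seats attack the cone statement `ConvClosedT` (no gate); the gate interaction was untouched (lead g23 FINAL (4)).  THIS FILE separates the two:
(1) ALGEBRA.  With `ν_i := gate_q μ_i`:  `gate_q(μ₁ ∗ μ₂) = ν₁ ∗ ν₂ + ((1−q)/q)·(δ₀ − ν₁) ∗ (δ₀ − ν₂)`, affine in `c = (1−q)/q` at FIXED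
`(ν₁, ν₂)`, fixed floor `q·x` and fixed target `q(T₁+T₂)` (the mean does not move).  DEC at a fixed target is a convex cone
(`decAtT_mixture`), so the admissible `c` form an interval; its endpoints are `c = 0` — the plain convolution `ν₁ ∗ ν₂` of two laws that are
DEC at every layer at floor `qx`, i.e. `ConvClosedT` (at the means, `decAt_lconv_of_convClosedT`) — and `c_max = p̄/(1 − p̄)`, `p̄ = min ν_i(0)`,
where the factor attaining the minimum becomes EMPTY-FREE: writing `p = μ₁(0) ≤ μ₂(0)`, `a = 1 − q + qp`, `μ₁⁺ = μ₁|_{≥1}/(1−p)`,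
`μ₂⋆ = (μ₂ − p·δ₀)/(1−p)` (a probability law because `μ₂(0) ≥ p`) and `q⋆ = q(1−p)`, one has EXACTLY
    `gate_q(lconv μ₁ μ₂) = (p/a)·lconv (gate_q μ₁) (gate_q μ₂) + ((1−q)(1−p)/a)·gate_{q⋆}(lconv μ₁⁺ μ₂⋆)`,
    `gate_{q⋆} μ₁⁺ = gate_q μ₁`,  `gate_{q⋆} μ₂⋆ = gate_q μ₂`   (`LawDec.gate_lconv_split`, `gate_posPart`, `gate_coPart`),
and `gate_s μ_i = gate_{s(1−p)}`-versions show that SDEC of `μ_i` at floor `x` is SDEC-up-to-gate-`(1−p)` of `μ₁⁺, μ₂⋆` at floor `x/(1−p)`.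
(2) Hence **`SDECConvClosed ⟸ ConvClosedT ∧ GatedConvEmptyFree`** (`sdecConvClosed_of_convClosedT_of_gatedConvEmptyFree`), where
`GatedConvEmptyFree` (CONJECTURE E) is the closure statement "SDEC up to gate `Q` is conv-closed WHEN ONE FACTOR HAS NO ATOM AT 0" — in the
tree recursion this is exactly the RELAY case `gate_q(δ₁ ∗ children)` / a subtree that is never empty when open.  Corollaries: `ConvClosedT ∧ E ⟹
TreeBuiltDEC`, `TreeDEC`, `FarTreeRow`.
EVIDENCE for E (exact LP, typer g25 `explore/gc1.py`, `gc2.py`; census-2 g51's `dec_lp`): the SINGLE-gate form (hypotheses `gate_q μ_i`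
DEC at every layer at floor `qx` for the SAME `q` only) has 0 failures on 1 089 boundary-pushed pairs (63 with a factor that is NOT DEC at
`q = 1`) and, with `μ₁(0) = 0`, 0 / 754 (both factors pushed to the boundary of their gate-`q` hypothesis); census-2 g53's SDEC-conv census
(0 / 22 789 pairs + 327, kit j131333/j131777/j131778) is evidence for both conjuncts.  HONEST STATUS: `GatedConvEmptyFree`, `ConvClosedT`,
`SDECConvClosed`, `TreeBuiltDEC`, `TreeDEC`, `FarTreeRow` remain OPEN; this file proves the reduction only.

* `LawDec.SDECUpTo x Q M μ` — SDEC for the gates `q ≤ Q` only (`SDEC = SDECUpTo · 1`, `sdecUpTo_one_iff`).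
* `LawDec.GatedConvEmptyFree` (`@[conjecture]`, E).
* `sdecUpTo_posPart`, `sdecUpTo_coPart` — SDEC of `μ_i` at floor `x` is SDEC-up-to-`(1−p)` of `posPart μ₁` / `coPart μ₁ μ₂` at `x/(1−p)`.
* `sdec_lconv_of_le` — the core under the normalisation `μ₁ 0 ≤ μ₂ 0`.
* **`LawDec.sdecConvClosed_of_convClosedT_of_gatedConvEmptyFree : ConvClosedT → GatedConvEmptyFree → SDECConvClosed`**;
  `treeBuiltDEC_of_convClosedT_of_gatedConvEmptyFree`, `Quant.treeDEC_of_convClosedT_of_gatedConvEmptyFree`,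
  `Quant.farTreeRow_of_convClosedT_of_gatedConvEmptyFree`.

[this work]; SDEC / the closure conjecture: prim-quant-census-2 g53; `ConvClosedT`: prim-quant-lead g22 (this lane).  The gluing rows served
[cite: KozmaNitzan2024, Conjecture 3 (p. 15)]; product measure [cite: Grimmett1999, §1.3 p. 10].
-/

noncomputable section

namespace Summit.CriticalPhenomena.PercolationContinuityZ3.Theorems

namespace Quant

open Finset

namespace LawDec

/-! ### SDEC up to a gate level, and Conjecture E -/

/-- **SDEC up to gate level `Q`**: for every gate `0 < q ≤ Q` and every layer `j′ < M`, the gated law `gate μ q` is DEC(j′) at floor `q·x`.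
`SDEC x M μ` is the case `Q = 1`. [this work] -/
def SDECUpTo (x Q : ℝ) (M : ℕ) (μ : ℕ → ℝ) : Prop :=
  ∀ q : ℝ, 0 < q → q ≤ Q → ∀ j' : ℕ, j' < M → DECAt (q * x) j' M (gate μ q)

/-- `SDEC` is `SDECUpTo` at level `1`. [this work] -/
theorem sdecUpTo_one_iff (x : ℝ) (M : ℕ) (μ : ℕ → ℝ) : SDECUpTo x 1 M μ ↔ SDEC x M μ := Iff.rfl

/-- **CONJECTURE E (EMPTY-FREE GATED CONVOLUTION; typer g25).**  For a base floor `0 < x ≤ 1`, a gate level `0 < Q ≤ 1` with `Q·x < 1`,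
and probability laws `μ₁` on `{0..M₁}`, `μ₂` on `{0..M₂}` (nonnegative, vanishing above the top, mass 1, top-affordable `x·Mᵢ ≤ mean`)
such that **`μ₁` HAS NO ATOM AT `0`** (`μ₁ 0 = 0`): if both are SDEC up to `Q` at floor `x` then so is `lconv M₁ M₂ μ₁ μ₂`.  Equivalently
(gate by gate): `gate_q μ₁`, `gate_q μ₂` DEC at every layer at floor `qx` for all `q ≤ Q` ⟹ `gate_q(μ₁ ∗ μ₂)` DEC at every layer at floor
`qx` for all `q ≤ Q`.  In the tree recursion (`law(N_v) = gate_{q_v}(δ_{[v ∈ A]} ∗ ∗_c law(N_c))`) the empty-free factor is the relay at the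
root.  Together with `ConvClosedT` it gives `SDECConvClosed` (`sdecConvClosed_of_convClosedT_of_gatedConvEmptyFree`: the general pair is an
explicit mixture of the plain convolution of the gated factors and of an empty-free instance, `gate_lconv_split`).  EVIDENCE (exact LP, typer
g25 `explore/gc2.py`): the stronger SINGLE-gate form (same `q` in hypotheses and conclusion, no smaller gates) has 0 failures on 754 pairs with
`μ₁(0) = 0`, both factors pushed to the boundary of their gate-`q` hypothesis (supports ≤ 4 atoms, tops ≤ 7, `q`, `x` on grids of mesh
1/8–1/12 plus `q ∈ {1/50, 99/100}`); and `gc1.py`: 0 / 1 089 for general pairs under same-`q` hypotheses.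
builds on p205010 (kernel theorem, internal audit signed; external expert review pending). [this work] [status: open] -/
@[conjecture] def GatedConvEmptyFree : Prop :=
  ∀ (x Q : ℝ) (M₁ M₂ : ℕ) (μ₁ μ₂ : ℕ → ℝ),
    0 < x → x ≤ 1 → 0 < Q → Q ≤ 1 → Q * x < 1 →
    (∀ h, 0 ≤ μ₁ h) → (∀ h, M₁ < h → μ₁ h = 0) → (∑ h ∈ Finset.range (M₁ + 1), μ₁ h = 1) →
    x * (M₁ : ℝ) ≤ ∑ h ∈ Finset.range (M₁ + 1), (h : ℝ) * μ₁ h →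
    (∀ h, 0 ≤ μ₂ h) → (∀ h, M₂ < h → μ₂ h = 0) → (∑ h ∈ Finset.range (M₂ + 1), μ₂ h = 1) →
    x * (M₂ : ℝ) ≤ ∑ h ∈ Finset.range (M₂ + 1), (h : ℝ) * μ₂ h →
    μ₁ 0 = 0 →
    SDECUpTo x Q M₁ μ₁ → SDECUpTo x Q M₂ μ₂ →
    SDECUpTo x Q (M₁ + M₂) (lconv M₁ M₂ μ₁ μ₂)

/-! ### SDEC of a law is SDEC-up-to-`(1−p)` of its empty-free part and of the co-factor, at base floor `x/(1−p)` -/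

/-- **transfer to the empty-free part**: `SDEC x M μ₁ → SDECUpTo (x/(1−p)) (1−p) M (posPart μ₁)` (`p = μ₁ 0 < 1`): the gate `q″ ≤ 1 − p`
of `posPart μ₁` is the gate `q″/(1−p)` of `μ₁` (`gate_posPart`). [this work] -/
theorem sdecUpTo_posPart {x : ℝ} {M : ℕ} {μ₁ : ℕ → ℝ} (hS : SDEC x M μ₁) (hp : μ₁ 0 < 1) :
    SDECUpTo (x / (1 - μ₁ 0)) (1 - μ₁ 0) M (posPart μ₁) := by
  intro q'' hq0 hq1 j' hj
  have h1p : 0 < 1 - μ₁ 0 := by linarith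
  have h := hS (q'' / (1 - μ₁ 0)) (div_pos hq0 h1p) (by rwa [div_le_one h1p]) j' hj
  have e : gate (posPart μ₁) q'' = gate μ₁ (q'' / (1 - μ₁ 0)) := by
    have := gate_posPart μ₁ (q'' / (1 - μ₁ 0)) (ne_of_lt hp)
    rwa [div_mul_cancel₀ _ (ne_of_gt h1p)] at this
  rw [e, show q'' * (x / (1 - μ₁ 0)) = q'' / (1 - μ₁ 0) * x by ring]
  exact h

/-- **transfer to the co-factor**: `SDEC x M μ₂ → SDECUpTo (x/(1−p)) (1−p) M (coPart μ₁ μ₂)` (`p = μ₁ 0 < 1`; `gate_coPart`). [this work] -/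
theorem sdecUpTo_coPart {x : ℝ} {M : ℕ} {μ₁ μ₂ : ℕ → ℝ} (hS : SDEC x M μ₂) (hp : μ₁ 0 < 1) :
    SDECUpTo (x / (1 - μ₁ 0)) (1 - μ₁ 0) M (coPart μ₁ μ₂) := by
  intro q'' hq0 hq1 j' hj
  have h1p : 0 < 1 - μ₁ 0 := by linarith
  have h := hS (q'' / (1 - μ₁ 0)) (div_pos hq0 h1p) (by rwa [div_le_one h1p]) j' hj
  have e : gate (coPart μ₁ μ₂) q'' = gate μ₂ (q'' / (1 - μ₁ 0)) := by
    have := gate_coPart μ₁ μ₂ (q'' / (1 - μ₁ 0)) (ne_of_lt hp)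
    rwa [div_mul_cancel₀ _ (ne_of_gt h1p)] at this
  rw [e, show q'' * (x / (1 - μ₁ 0)) = q'' / (1 - μ₁ 0) * x by ring]
  exact h

/-! ### The reduction -/

/-- the core, under the normalisation `μ₁ 0 ≤ μ₂ 0`. [this work] -/
theorem sdec_lconv_of_le (hC : ConvClosedT) (hE : GatedConvEmptyFree) (x : ℝ) (M₁ M₂ : ℕ) (μ₁ μ₂ : ℕ → ℝ)
    (hx0 : 0 < x) (hx1 : x < 1)
    (h10 : ∀ h, 0 ≤ μ₁ h) (h1M : ∀ h, M₁ < h → μ₁ h = 0) (h11 : ∑ h ∈ Finset.range (M₁ + 1), μ₁ h = 1)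
    (hta1 : x * (M₁ : ℝ) ≤ ∑ h ∈ Finset.range (M₁ + 1), (h : ℝ) * μ₁ h)
    (h20 : ∀ h, 0 ≤ μ₂ h) (h2M : ∀ h, M₂ < h → μ₂ h = 0) (h21 : ∑ h ∈ Finset.range (M₂ + 1), μ₂ h = 1)
    (hta2 : x * (M₂ : ℝ) ≤ ∑ h ∈ Finset.range (M₂ + 1), (h : ℝ) * μ₂ h)
    (hS1 : SDEC x M₁ μ₁) (hS2 : SDEC x M₂ μ₂) (hle : μ₁ 0 ≤ μ₂ 0) :
    SDEC x (M₁ + M₂) (lconv M₁ M₂ μ₁ μ₂) := by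
  intro q hq0 hq1 j hj
  set T₁ : ℝ := ∑ h ∈ Finset.range (M₁ + 1), (h : ℝ) * μ₁ h with hT₁
  set T₂ : ℝ := ∑ h ∈ Finset.range (M₂ + 1), (h : ℝ) * μ₂ h with hT₂
  -- case `μ₁ 0 = 0`: Conjecture E at base floor `x`, level `1`
  by_cases hp0 : μ₁ 0 = 0
  · exact hE x 1 M₁ M₂ μ₁ μ₂ hx0 hx1.le one_pos le_rfl (by linarith) h10 h1M h11 hta1 h20 h2M h21 hta2 hp0
      ((sdecUpTo_one_iff x M₁ μ₁).2 hS1) ((sdecUpTo_one_iff x M₂ μ₂).2 hS2) q hq0 hq1 j hj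
  -- bounds on `p = μ₁ 0`
  have hT1le : T₁ ≤ (M₁ : ℝ) * (1 - μ₁ 0) := sum_mul_le_top_mul M₁ μ₁ h10 h11
  have hT2le : T₂ ≤ (M₂ : ℝ) * (1 - μ₂ 0) := sum_mul_le_top_mul M₂ μ₂ h20 h21
  -- case `μ₁ 0 = 1`: both laws are `δ₀`, so `M₁ = M₂ = 0` and there is no layer
  by_cases hp1 : μ₁ 0 = 1
  · exfalso
    have hM1 : (M₁ : ℝ) ≤ 0 := by
      by_contra hc
      have : 0 < x * (M₁ : ℝ) := mul_pos hx0 (not_le.1 hc)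
      rw [hp1] at hT1le
      linarith
    have h2le1 : μ₂ 0 ≤ 1 := by
      have := Finset.single_le_sum (fun h _ => h20 h) (Finset.mem_range.2 (Nat.succ_pos M₂))
      rw [h21] at this; exact this
    have hM2 : (M₂ : ℝ) ≤ 0 := by
      by_contra hc
      have : 0 < x * (M₂ : ℝ) := mul_pos hx0 (not_le.1 hc)
      have : (M₂ : ℝ) * (1 - μ₂ 0) ≤ 0 := mul_nonpos_of_nonneg_of_nonpos (Nat.cast_nonneg _) (by rw [hp1] at hle; linarith)
      linarith
    have : M₁ = 0 := by exact_mod_cast le_antisymm hM1 (Nat.cast_nonneg _)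
    have : M₂ = 0 := by exact_mod_cast le_antisymm hM2 (Nat.cast_nonneg _)
    omega
  -- general case `0 < p < 1`
  have hpos : 0 < μ₁ 0 := lt_of_le_of_ne (h10 0) (Ne.symm hp0)
  have hlt1 : μ₁ 0 < 1 := by
    have := Finset.single_le_sum (fun h _ => h10 h) (Finset.mem_range.2 (Nat.succ_pos M₁))
    rw [h11] at this
    exact lt_of_le_of_ne this hp1
  have h1p : 0 < 1 - μ₁ 0 := by linarith
  have ha : 0 < 1 - q + q * μ₁ 0 := by nlinarith
  have hqx0 : 0 < q * x := mul_pos hq0 hx0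
  have hqx1 : q * x < 1 := by nlinarith
  -- (A) the plain convolution of the gated factors: `ConvClosedT` at floor `qx`
  obtain ⟨n10, n1M, n11⟩ := gate_laws M₁ μ₁ q hq0.le hq1 h10 h1M h11
  obtain ⟨n20, n2M, n21⟩ := gate_laws M₂ μ₂ q hq0.le hq1 h20 h2M h21
  have hmean1 : ∑ k ∈ Finset.range (M₁ + 1), (k : ℝ) * gate μ₁ q k = q * T₁ := sum_mul_gate μ₁ q M₁
  have hmean2 : ∑ k ∈ Finset.range (M₂ + 1), (k : ℝ) * gate μ₂ q k = q * T₂ := sum_mul_gate μ₂ q M₂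
  have htaν : ∀ (M : ℕ) (μ : ℕ → ℝ) (T : ℝ), (∀ h, M < h → gate μ q h = 0) → x * (M : ℝ) ≤ T →
      (∑ k ∈ Finset.range (M + 1), (k : ℝ) * gate μ q k = q * T) →
      ∀ h, 0 < gate μ q h → q * x * (h : ℝ) ≤ ∑ k ∈ Finset.range (M + 1), (k : ℝ) * gate μ q k := by
    intro M μ T hvan hta hmean h hh
    have hhM : h ≤ M := by
      by_contra hc; exact absurd (hvan h (not_le.1 hc)) (ne_of_gt hh)
    rw [hmean]
    have : q * x * (h : ℝ) ≤ q * x * (M : ℝ) := mul_le_mul_of_nonneg_left (by exact_mod_cast hhM) hqx0.le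
    nlinarith
  have hA : DECAt (q * x) j (M₁ + M₂) (lconv M₁ M₂ (gate μ₁ q) (gate μ₂ q)) :=
    decAt_lconv_of_convClosedT hC (q * x) M₁ M₂ (gate μ₁ q) (gate μ₂ q) hqx0 hqx1 n10 n1M n11 n20 n2M n21
      (htaν M₁ μ₁ T₁ n1M hta1 hmean1) (htaν M₂ μ₂ T₂ n2M hta2 hmean2)
      (fun j'' hj'' => hS1 q hq0 hq1 j'' hj'') (fun j'' hj'' => hS2 q hq0 hq1 j'' hj'') j hj
  -- (B) the empty-free instance: Conjecture E at base floor `x/(1−p)`, level `1−p`, gate `q(1−p)`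
  obtain ⟨m10, m1M, m11, mmean1, mzero⟩ := posPart_laws M₁ μ₁ h10 h1M h11 hlt1
  obtain ⟨m20, m2M, m21, mmean2⟩ := coPart_laws M₂ μ₁ μ₂ h20 h2M h21 hlt1 hle
  have hM1pos : 0 < (M₁ : ℝ) := by
    have hM1 : M₁ ≠ 0 := by
      rintro rfl
      rw [Finset.sum_range_one] at h11
      exact hp1 h11
    exact_mod_cast Nat.pos_of_ne_zero hM1
  have hxle : x ≤ 1 - μ₁ 0 := by
    by_contra hc
    have : (M₁ : ℝ) * (1 - μ₁ 0) < x * (M₁ : ℝ) := by nlinarith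
    linarith
  have hx'0 : 0 < x / (1 - μ₁ 0) := div_pos hx0 h1p
  have hx'1 : x / (1 - μ₁ 0) ≤ 1 := by rwa [div_le_one h1p]
  have hQx : (1 - μ₁ 0) * (x / (1 - μ₁ 0)) < 1 := by rw [mul_div_cancel₀ _ (ne_of_gt h1p)]; exact hx1
  have hta1' : x / (1 - μ₁ 0) * (M₁ : ℝ) ≤ ∑ h ∈ Finset.range (M₁ + 1), (h : ℝ) * posPart μ₁ h := by
    rw [mmean1, div_mul_eq_mul_div]
    exact div_le_div_of_nonneg_right hta1 h1p.le
  have hta2' : x / (1 - μ₁ 0) * (M₂ : ℝ) ≤ ∑ h ∈ Finset.range (M₂ + 1), (h : ℝ) * coPart μ₁ μ₂ h := by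
    rw [mmean2, div_mul_eq_mul_div]
    exact div_le_div_of_nonneg_right hta2 h1p.le
  have hE' := hE (x / (1 - μ₁ 0)) (1 - μ₁ 0) M₁ M₂ (posPart μ₁) (coPart μ₁ μ₂) hx'0 hx'1 h1p (by linarith) hQx
    m10 m1M m11 hta1' m20 m2M m21 hta2' mzero (sdecUpTo_posPart hS1 hlt1) (sdecUpTo_coPart hS2 hlt1)
    (q * (1 - μ₁ 0)) (mul_pos hq0 h1p) (mul_le_of_le_one_left h1p.le hq1) j hj
  have hB : DECAt (q * x) j (M₁ + M₂) (gate (lconv M₁ M₂ (posPart μ₁) (coPart μ₁ μ₂)) (q * (1 - μ₁ 0))) := by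
    have e : q * (1 - μ₁ 0) * (x / (1 - μ₁ 0)) = q * x := by field_simp
    rw [e] at hE'
    exact hE'
  -- targets: all three laws have mean `q(T₁ + T₂)`
  have hτ : ∑ k ∈ Finset.range (M₁ + M₂ + 1), (k : ℝ) * gate (lconv M₁ M₂ μ₁ μ₂) q k = q * (T₁ + T₂) := by
    rw [sum_mul_gate, sum_mul_lconv M₁ M₂ μ₁ μ₂ h11 h21]
  have hτA : ∑ k ∈ Finset.range (M₁ + M₂ + 1), (k : ℝ) * lconv M₁ M₂ (gate μ₁ q) (gate μ₂ q) k = q * (T₁ + T₂) := by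
    rw [sum_mul_lconv M₁ M₂ _ _ n11 n21, hmean1, hmean2]; ring
  have hτB : ∑ k ∈ Finset.range (M₁ + M₂ + 1), (k : ℝ) * gate (lconv M₁ M₂ (posPart μ₁) (coPart μ₁ μ₂)) (q * (1 - μ₁ 0)) k
      = q * (T₁ + T₂) := by
    rw [sum_mul_gate, sum_mul_lconv M₁ M₂ _ _ m11 m21, mmean1, mmean2, hT₁, hT₂]
    field_simp
  rw [decAt_iff_decAtT, hτA] at hA
  rw [decAt_iff_decAtT, hτB] at hB
  rw [decAt_iff_decAtT, hτ]
  -- the split identity and the mixture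
  have hsplit : gate (lconv M₁ M₂ μ₁ μ₂) q = fun h =>
      (μ₁ 0 / (1 - q + q * μ₁ 0)) * lconv M₁ M₂ (gate μ₁ q) (gate μ₂ q) h +
      (1 - μ₁ 0 / (1 - q + q * μ₁ 0)) * gate (lconv M₁ M₂ (posPart μ₁) (coPart μ₁ μ₂)) (q * (1 - μ₁ 0)) h := by
    funext h
    rw [gate_lconv_split M₁ M₂ μ₁ μ₂ q h1M h2M hp1 (ne_of_gt ha) h]
    congr 1
    have : (1 - q) * (1 - μ₁ 0) / (1 - q + q * μ₁ 0) = 1 - μ₁ 0 / (1 - q + q * μ₁ 0) := by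
      field_simp; ring
    rw [this]
  rw [hsplit]
  exact decAtT_mixture _ (div_nonneg hpos.le ha.le) (by rw [div_le_one ha]; nlinarith) hA hB

/-- **THE REDUCTION: `ConvClosedT ∧ GatedConvEmptyFree ⟹ SDECConvClosed`.**  For SDEC factors at floor `x` and a gate `q`, the gated
convolution is an explicit mixture (`gate_lconv_split`) of the plain convolution of the gated factors (DEC by `ConvClosedT` at floor `qx`,
`decAt_lconv_of_convClosedT`) and of the gated convolution of the EMPTY-FREE part of the factor with the smaller atom at `0` with the
co-factor, at gate `q(1−p)` and base floor `x/(1−p)` (DEC by Conjecture E; the SDEC hypotheses transfer by `sdecUpTo_posPart` /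
`sdecUpTo_coPart`); all three laws have mean `q(T₁+T₂)`, so `decAtT_mixture` applies.  The other order by `lconv_comm`. [this work] -/
theorem sdecConvClosed_of_convClosedT_of_gatedConvEmptyFree (hC : ConvClosedT) (hE : GatedConvEmptyFree) : SDECConvClosed := by
  intro x M₁ M₂ μ₁ μ₂ hx0 hx1 h10 h1M h11 hta1 h20 h2M h21 hta2 hS1 hS2
  rcases le_total (μ₁ 0) (μ₂ 0) with hle | hle
  · exact sdec_lconv_of_le hC hE x M₁ M₂ μ₁ μ₂ hx0 hx1 h10 h1M h11 hta1 h20 h2M h21 hta2 hS1 hS2 hle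
  · have h := sdec_lconv_of_le hC hE x M₂ M₁ μ₂ μ₁ hx0 hx1 h20 h2M h21 hta2 h10 h1M h11 hta1 hS2 hS1 hle
    rw [lconv_comm, Nat.add_comm]
    exact h

/-- **`ConvClosedT ∧ E ⟹` every tree-built count law is DEC(j′) at every layer (`LawDec.TreeBuiltDEC`).** [this work] -/
theorem treeBuiltDEC_of_convClosedT_of_gatedConvEmptyFree (hC : ConvClosedT) (hE : GatedConvEmptyFree) : TreeBuiltDEC :=
  treeBuiltDEC_of_sdecConvClosed (sdecConvClosed_of_convClosedT_of_gatedConvEmptyFree hC hE)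

end LawDec

/-- **`ConvClosedT ∧ E ⟹ Quant.TreeDEC`** (census-2 g53 / lead g20's bridge). [this work] -/
theorem treeDEC_of_convClosedT_of_gatedConvEmptyFree (hC : LawDec.ConvClosedT) (hE : LawDec.GatedConvEmptyFree) : TreeDEC :=
  treeDEC_of_sdecConvClosed (LawDec.sdecConvClosed_of_convClosedT_of_gatedConvEmptyFree hC hE)

/-- **`ConvClosedT ∧ E ⟹ Quant.FarTreeRow`** — the tree row of R8 is the cone statement `ConvClosedT` (attacked by the census seats) plus
the empty-free gated convolution E.  CONDITIONAL result; both hypotheses are `@[conjecture]`s. [this work] -/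
theorem farTreeRow_of_convClosedT_of_gatedConvEmptyFree (hC : LawDec.ConvClosedT) (hE : LawDec.GatedConvEmptyFree) : FarTreeRow :=
  farTreeRow_of_sdecConvClosed (LawDec.sdecConvClosed_of_convClosedT_of_gatedConvEmptyFree hC hE)

end Quant

end Summit.CriticalPhenomena.PercolationContinuityZ3.Theorems
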